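/-
Copyright (c) 2026 the pub-hodgecm-mathlib formalisation cell (harness21).  Prover seat hodgecm-mathlib-K2E3-p03 (g3): Track B «K2-LIT», crux H413, unit U3b «central
germs», road (d-w) «wild plane mass identity» (owner): the ONE local-algebra input shared by the (C2b-i) top-index brick and the (C2b-ii) ladder brick, 2026-09-04.
-/
import Literature.NumberTheory.LocalFields.WildQuadraticDatumNormSignConductor   -- ★ conductor toolkit: `exists_unit_v_sub_mul_map_le`, `exists_fixed_unit_not_norm_v_sub_one_le`, `exists_mul_map_eq_of_fixed_of_v_sub_one_le_pred`, `exists_nonnorm_dichotomy`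
import Literature.NumberTheory.LocalFields.WildQuadraticDatumNormOneQuotient     -- ★ `two_le_of_v_two_lt_one`
import HarnessLib

/-!
# The binary norm form `a·σa − ξ·c·σc` on `𝒪_E ⊕ 𝒪_E` takes EVERY σ-fixed unit value at a wild ramified quadratic datum
# (reduced norm of the quaternion order `Λ = 𝒪_E ⊕ 𝒪_E·j`, `j² = ξ`: `nrd(Λ^×) = U_F`; Serre, *Local Fields* V §3, datum currency)

Topic `NumberTheory/LocalFields`; namespace `Literature.NumberTheory.LocalFields.WildQuadraticDatum` (the one-field datum ★ `IsRamifiedQuadraticDatum σ ϖ d t`: `σ` an involution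
of the valued field `K = E` with `v ∘ σ = v`, fixed field `F`, `σ`-fixed non-zero elements of even valuation, `|ϖ| = exp(−1)`, `|ϖ − σϖ| = |ϖ|^d`, `|2| = |ϖ|^t`).  THEOREMS ONLY
(no definition, no instance, no notation, no named fact, no `sorry`); kernel lane `--supports stmt-HodgeConjecture-24833` (count-neutral).

THE QUESTION.  At a wild (`|2| < 1`) ramified quadratic datum let `ξ` be a `σ`-fixed unit (in the application: a unit of `F` which is NOT a norm from `E`, so that the quaternion
algebra `D = E ⊕ E·j`, `j² = ξ`, `jz = σ(z)j`, is a division algebra and the hermitian plane `⟨1, −ξ⟩` is anisotropic).  The reduced norm of `a + c·j` is `N a − ξ·N c`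
(`N z = z·σz`), and the order `Λ = 𝒪_E ⊕ 𝒪_E·j` has unit group `Λ^× = {a + cj : |a|, |c| ≤ 1, |Na − ξNc| = 1}`.  The norms OF UNITS `N(𝒪_E^×)` form a subgroup of index
EXACTLY two in the fixed units `U_F` (ramified!), so `nrd(Λ^×) = U_F` is NOT automatic: one needs ONE element of `Λ` whose reduced norm is a unit and NOT a norm.
* §1 `exists_one_sub_mul_norm_not_norm` — THE WITNESS: `z = ϖ^{d−1}·u` (`u` a suitable unit) has `1 − ξ·N z` a unit which is NOT a norm.  PROOF (the conductor of `E∕F` is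
  exactly `d`): ★ `exists_fixed_unit_not_norm_v_sub_one_le` gives a fixed NON-norm unit `c` with `|c − 1| ≤ exp(−2(d−1))`, and `|c − 1| = exp(−2(d−1))` on the nose because a
  fixed unit with `|c − 1| ≤ |ϖ|^{2d−1}` IS a norm (★ `exists_mul_map_eq_of_fixed_of_v_sub_one_le_pred`); write `c = 1 + P·W` with `P = (ϖσϖ)^{d−1}`, `W` a fixed unit; ★
  `exists_unit_v_sub_mul_map_le` gives a unit `u` with `|−W∕ξ − N u| ≤ exp(−2(d−1))`; then `x := 1 − ξ·N(ϖ^{d−1}u) = c + P·(−ξ)·(N u + W∕ξ)` satisfies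
  `|x − c| ≤ exp(−4(d−1)) ≤ |ϖ|^{2d−1}` (`d ≥ 2` at a wild datum, ★ `two_le_of_v_two_lt_one`), so `x∕c` is a norm and `x` is not.
* §2 `exists_norm_sub_mul_norm_eq_of_fixed_unit` — **EVERY FIXED UNIT `w` IS `N a − ξ·N c` WITH `|a| = 1`, `|c| ≤ 1`** (`nrd(Λ^×) = U_F`): by the index-two dichotomy ★
  `exists_nonnorm_dichotomy` either `w = N y` (take `a = y`, `c = 0`) or `w∕x = N y` for the §1 witness `x = 1 − ξ·N z` (take `a = y`, `c = z·σy`: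
  `N y − ξ·N(z·σy) = N y·(1 − ξ·N z)`).
These are the inputs «`nrd(Λ^×) = 𝒪_F^×`» of the residual counts `[D¹ : Λ¹] = (q+1)q^{d−2}` and `[Λ¹ : Λ¹(4Λ)] = q^{6m−⌊d∕2⌋}` on the (d-w) road of crux H413 (road owner's
TARGETS table), used through the kernel–image index identity `[ker f : ker f ∩ N] = [G : N] ∕ [f(G) : f(N)]` with `f = nrd` on `G = Λ^×` resp. `𝒪_D^×`.
HONEST LABEL: HC_CM is proved only modulo the 7 printed citations (2 remaining named inputs: hLiu418 = stmt-HodgeConjecture-24832, h413 = stmt-HodgeConjecture-24833) until rung 0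
closes; unconditional local algebra, count-neutral.

## References
* [Serre1979] J.-P. Serre, *Local Fields*, GTM 67 (1979): Ch. V §3 Prop. 5, Cor. 2–3 pp. 85–87 (norm groups and the conductor of a totally ramified quadratic extension).
* [NeukirchANT1999] J. Neukirch, *Algebraic Number Theory* (1999): Ch. V (1.3) (local norm index two).
-/

set_option autoImplicit false

noncomputable section

open WithZero
open scoped Valued
open Literature.NumberTheory.Automorphic.UnitaryThreeFourFrame

namespace Literature.NumberTheory.LocalFields.WildQuadraticDatum

variable {K : Type} [Field K] [Valued K ℤᵐ⁰] {σ : K →+* K} {ϖ : K} {d t : ℕ}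

/-! ## §0 Two algebraic letters on the norm map `N z = z·σz` -/

omit [Valued K ℤᵐ⁰] in
/-- Norms divide: `(y₁σy₁) ∕ (y₂σy₂) = (y₁∕y₂)·σ(y₁∕y₂)`. [cite: Serre1979, Ch. V §3 Prop. 5] -/
theorem mul_map_div_mul_map (y₁ y₂ : K) : (y₁ * σ y₁) / (y₂ * σ y₂) = (y₁ / y₂) * σ (y₁ / y₂) := by
  rw [map_div₀]; ring

omit [Valued K ℤᵐ⁰] in
/-- The reduced norm of `(1 + z·j)·y = y + (z·σy)·j` in `D = E ⊕ E·j` (`j² = ξ`, `jy = σ(y)j`): `N y − ξ·N(z·σy) = N y · (1 − ξ·N z)` (`σ` an involution).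
[cite: Serre1979, Ch. V §3 Prop. 5] -/
theorem mul_map_sub_mul_mul_map_mul_map (hσ : ∀ x, σ (σ x) = x) (ξ z y : K) :
    y * σ y - ξ * ((z * σ y) * σ (z * σ y)) = (y * σ y) * (1 - ξ * (z * σ z)) := by
  rw [map_mul, hσ]; ring

/-! ## §1 The witness: an element `1 + z·j ∈ Λ` whose reduced norm `1 − ξ·N z` is a unit and NOT a norm -/

/-- **A NON-NORM UNIT VALUE `1 − ξ·N z` WITH `|z| = |ϖ|^{d−1}`** at a wild ramified quadratic datum (`|2| < 1`), for every `σ`-fixed unit `ξ`: there is `z` with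
`|z| = |ϖ|^{d−1}` such that `1 − ξ·zσz` is a unit which is not of the form `y·σy`.  (The conductor of `E∕F` is exactly `d`: a fixed non-norm `c ≡ 1 (mod 𝔭_F^{d−1})` exists and
every fixed `u ≡ 1 (mod 𝔭_F^{d})` is a norm; `1 − ξ·N(ϖ^{d−1}u)` is steered into `c·U_F^{(d)}` by choosing the residue of `N u`.) [cite: Serre1979, Ch. V §3 Prop. 5, Cor. 2–3 pp. 85–87] -/
theorem exists_one_sub_mul_norm_not_norm [CompleteSpace K] [Finite 𝓀[K]] (hD : IsRamifiedQuadraticDatum σ ϖ d t) (h2v : Valued.v (2 : K) < 1)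
    {ξ : K} (hσξ : σ ξ = ξ) (hξ1 : Valued.v ξ = 1) :
    ∃ z : K, Valued.v z = Valued.v ϖ ^ (d - 1) ∧ Valued.v (1 - ξ * (z * σ z)) = 1 ∧ ¬ ∃ y : K, y * σ y = 1 - ξ * (z * σ z) := by
  have hD' := hD
  obtain ⟨hσ, hvσ, hϖ, hfix, hdiff, -, ht⟩ := hD'
  have h2d : 2 ≤ d := two_le_of_v_two_lt_one hσ hvσ hfix hϖ hdiff ht h2v
  have hξ0 : ξ ≠ 0 := fun h => by rw [h, map_zero] at hξ1; exact zero_ne_one hξ1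
  -- the non-norm `c` at the break
  obtain ⟨c, hσc, hc1, hcle, hcn⟩ := exists_fixed_unit_not_norm_v_sub_one_le hD h2v
  have hc0 : c ≠ 0 := fun h => by rw [h, map_zero] at hc1; exact zero_ne_one hc1
  -- `P := (ϖσϖ)^(d−1)`, a fixed element of valuation `exp(−2(d−1))`
  set P : K := (ϖ * σ ϖ) ^ (d - 1) with hP
  have hvP : Valued.v P = exp (-(2 * ((d - 1 : ℕ) : ℤ))) := v_normVarpi_pow hvσ hϖ (d - 1)
  have hvP0 : Valued.v P ≠ 0 := by rw [hvP]; exact exp_ne_zero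
  have hP0 : P ≠ 0 := (Valuation.ne_zero_iff _).1 hvP0
  have hσP : σ P = P := by rw [hP, map_pow, map_mul_map hσ]
  -- `W := (c − 1) ∕ P` is a fixed UNIT: `|c − 1| = |P|` on the nose
  set W : K := (c - 1) / P with hW
  have hσW : σ W = W := by rw [hW, map_div₀, map_sub, hσc, map_one, hσP]
  have hcW : c = 1 + P * W := by rw [hW, mul_div_cancel₀ _ hP0]; ring
  have hσc1 : σ (c - 1) = c - 1 := by rw [map_sub, hσc, map_one]
  have hW1 : Valued.v W = 1 := by
    have hle : Valued.v (c - 1) ≤ Valued.v P := by rw [hvP]; exact hcle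
    rcases hle.lt_or_eq with hlt | heq
    · exfalso
      have hlt' : Valued.v (c - 1) < exp (2 * (-((d - 1 : ℕ) : ℤ))) := by
        rw [hvP] at hlt; convert hlt using 2; ring
      have h1 := v_le_exp_of_fixed_of_v_lt hfix hσc1 hlt'
      have h2 : Valued.v (c - 1) ≤ Valued.v ϖ ^ (2 * d - 1) := by
        refine h1.trans ?_
        rw [v_varpi_pow hϖ, exp_le_exp]; omega
      exact hcn (exists_mul_map_eq_of_fixed_of_v_sub_one_le_pred hD hσc le_rfl h2)
    · rw [hW, map_div₀, heq, div_self hvP0]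
  -- `γ := −W∕ξ`, a fixed unit, is a norm `N u` to order `2(d−1)`
  have hσγ : σ (-W / ξ) = -W / ξ := by rw [map_div₀, map_neg, hσW, hσξ]
  have hγ1 : Valued.v (-W / ξ) = 1 := by rw [map_div₀, Valuation.map_neg, hW1, hξ1, div_one]
  obtain ⟨u, hu1, hγu⟩ := exists_unit_v_sub_mul_map_le hD h2v hσγ hγ1
  -- the witness `z := ϖ^(d−1)·u`; `x := 1 − ξ·N z = c + P·(−ξ)·(N u − γ)`
  refine ⟨ϖ ^ (d - 1) * u, by rw [map_mul, map_pow, hu1, mul_one], ?_⟩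
  have hNz : (ϖ ^ (d - 1) * u) * σ (ϖ ^ (d - 1) * u) = P * (u * σ u) := by
    rw [hP, map_mul, map_pow, mul_pow]; ring
  set x : K := 1 - ξ * ((ϖ ^ (d - 1) * u) * σ (ϖ ^ (d - 1) * u)) with hx
  have hxc : x = c + P * (-ξ) * (u * σ u - -W / ξ) := by
    rw [hx, hNz, hcW]; field_simp; ring
  have hσx : σ x = x := by
    rw [hx, map_sub, map_one, map_mul, hσξ, map_mul_map hσ]
  -- `|x − c| ≤ exp(−4(d−1)) ≤ |ϖ|^(2d−1)`
  have hxc_le : Valued.v (x - c) ≤ Valued.v ϖ ^ (2 * d - 1) := by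
    have h1 : Valued.v (x - c) ≤ exp (-(2 * ((d - 1 : ℕ) : ℤ))) * exp (-(2 * ((d - 1 : ℕ) : ℤ))) := by
      rw [hxc, add_sub_cancel_left, map_mul, map_mul, Valuation.map_neg, hvP, hξ1, mul_one]
      refine mul_le_mul' le_rfl ?_
      rwa [← Valuation.map_neg, neg_sub] at hγu
    refine h1.trans ?_
    rw [← exp_add, v_varpi_pow hϖ, exp_le_exp]; omega
  have hxc_lt : Valued.v (x - c) < Valued.v c := by
    rw [hc1]
    refine lt_of_le_of_lt hxc_le ?_
    rw [v_varpi_pow hϖ, ← exp_zero, exp_lt_exp]; omega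
  -- so `x` is a unit and `x ∕ c ∈ U_F(2d−1)` is a norm
  have hx1 : Valued.v x = 1 := by rw [← hc1]; exact Valuation.map_eq_of_sub_lt _ hxc_lt
  have hx0 : x ≠ 0 := fun h => by rw [h, map_zero] at hx1; exact zero_ne_one hx1
  have hσxc : σ (x / c) = x / c := by rw [map_div₀, hσx, hσc]
  have hxc1 : Valued.v (x / c - 1) ≤ Valued.v ϖ ^ (2 * d - 1) := by
    rw [div_sub_one hc0, map_div₀, hc1, div_one]; exact hxc_le
  obtain ⟨y, hy⟩ := exists_mul_map_eq_of_fixed_of_v_sub_one_le_pred hD hσxc le_rfl hxc1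
  have hy0 : y ≠ 0 := by
    rintro rfl
    rw [zero_mul, eq_comm, div_eq_zero_iff] at hy
    exact hy.elim hx0 hc0
  refine ⟨hx1, ?_⟩
  -- if `x = N y'` then `c = x ∕ (x∕c) = N(y'∕y)`, contradicting `c ∉ N`
  rintro ⟨y', hy'⟩
  refine hcn ⟨y' / y, ?_⟩
  rw [← mul_map_div_mul_map, hy, hy']
  field_simp

/-! ## §2 Every fixed unit is a value `N a − ξ·N c` with `|a| = 1`, `|c| ≤ 1`: `nrd(Λ^×) = U_F` -/

/-- **`nrd(Λ^×) = U_F`: EVERY `σ`-FIXED UNIT `w` IS `a·σa − ξ·(c·σc)` WITH `|a| = 1`, `|c| ≤ 1`** at a wild ramified quadratic datum (`|2| < 1`; `ξ` any `σ`-fixed unit) — the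
index-two dichotomy (★ `exists_nonnorm_dichotomy`): either `w = N y` (`a = y`, `c = 0`) or `w` and the §1 non-norm `x = 1 − ξ·N z` differ by a norm `N y`, and then
`(1 + z·j)·y ∈ Λ` has reduced norm `N y·x = w` (`a = y`, `c = z·σy`). [cite: Serre1979, Ch. V §3 Prop. 5, Cor. 2–3 pp. 85–87] [cite: NeukirchANT1999, Ch. V (1.3)] -/
theorem exists_norm_sub_mul_norm_eq_of_fixed_unit [CompleteSpace K] [Finite 𝓀[K]] (hD : IsRamifiedQuadraticDatum σ ϖ d t) (h2v : Valued.v (2 : K) < 1)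
    {ξ : K} (hσξ : σ ξ = ξ) (hξ1 : Valued.v ξ = 1) {w : K} (hσw : σ w = w) (hw1 : Valued.v w = 1) :
    ∃ a c : K, Valued.v a = 1 ∧ Valued.v c ≤ 1 ∧ a * σ a - ξ * (c * σ c) = w := by
  have hD' := hD
  obtain ⟨hσ, hvσ, hϖ, -, -, -, -⟩ := hD'
  have hw0 : w ≠ 0 := fun h => by rw [h, map_zero] at hw1; exact zero_ne_one hw1
  obtain ⟨c₀, hσc₀, hc₀n, hdich⟩ := exists_nonnorm_dichotomy hD
  rcases hdich w hσw hw0 with ⟨y, hy⟩ | ⟨y₁, hy₁⟩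
  · -- `w = N y`: `a = y`, `c = 0`
    refine ⟨y, 0, v_eq_one_of_v_mul_map_eq_one hvσ (by rw [hy, hw1]), by rw [map_zero]; exact zero_le_one, ?_⟩
    rw [map_zero, mul_zero, mul_zero, sub_zero, hy]
  · -- `w ∉ N`: compare with the §1 non-norm `x`
    obtain ⟨z, hvz, hx1, hxn⟩ := exists_one_sub_mul_norm_not_norm hD h2v hσξ hξ1
    set x : K := 1 - ξ * (z * σ z) with hx
    have hx0 : x ≠ 0 := fun h => by rw [h, map_zero] at hx1; exact zero_ne_one hx1
    have hσx : σ x = x := by rw [hx, map_sub, map_one, map_mul, hσξ, map_mul_map hσ]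
    rcases hdich x hσx hx0 with hxN | ⟨y₂, hy₂⟩
    · exact absurd hxN hxn
    -- `c₀·w = N y₁`, `c₀·x = N y₂` ⇒ `w ∕ x = N(y₁∕y₂)`
    have hc₀0 : c₀ ≠ 0 := by
      rintro rfl
      exact hc₀n ⟨0, by rw [zero_mul]⟩
    have hy₂0 : y₂ ≠ 0 := by
      rintro rfl
      rw [zero_mul, eq_comm, mul_eq_zero] at hy₂
      exact hy₂.elim hc₀0 hx0
    have hwx : (y₁ / y₂) * σ (y₁ / y₂) = w / x := by
      rw [← mul_map_div_mul_map, hy₁, hy₂, mul_div_mul_left _ _ hc₀0]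
    have hz1 : Valued.v z ≤ 1 := by
      rw [hvz]
      exact pow_le_one₀ zero_le (by rw [hϖ, ← exp_zero, exp_le_exp]; norm_num)
    have hy1 : Valued.v (y₁ / y₂) = 1 := v_eq_one_of_v_mul_map_eq_one hvσ (by rw [hwx, map_div₀, hw1, hx1, div_one])
    refine ⟨y₁ / y₂, z * σ (y₁ / y₂), hy1, ?_, ?_⟩
    · rw [map_mul, hvσ, hy1, mul_one]
      exact hz1
    · rw [mul_map_sub_mul_mul_map_mul_map hσ, hwx, ← hx, div_mul_cancel₀ _ hx0]

/-- The same with `|a| ≤ 1` (the shape `(a, c) ∈ 𝒪_E ⊕ 𝒪_E = Λ` of the order bricks): every `σ`-fixed unit is the reduced norm `N a − ξ·N c` of an element of `Λ` (necessarily a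
unit of `Λ`). [cite: Serre1979, Ch. V §3 Prop. 5, Cor. 2–3 pp. 85–87] -/
theorem exists_v_le_one_norm_sub_mul_norm_eq [CompleteSpace K] [Finite 𝓀[K]] (hD : IsRamifiedQuadraticDatum σ ϖ d t) (h2v : Valued.v (2 : K) < 1)
    {ξ : K} (hσξ : σ ξ = ξ) (hξ1 : Valued.v ξ = 1) {w : K} (hσw : σ w = w) (hw1 : Valued.v w = 1) :
    ∃ a c : K, Valued.v a ≤ 1 ∧ Valued.v c ≤ 1 ∧ a * σ a - ξ * (c * σ c) = w := by
  obtain ⟨a, c, ha, hc, h⟩ := exists_norm_sub_mul_norm_eq_of_fixed_unit hD h2v hσξ hξ1 hσw hw1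
  exact ⟨a, c, ha.le, hc, h⟩

end Literature.NumberTheory.LocalFields.WildQuadraticDatum
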